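import Summits.QuantumFields.YangMills.Theorems.UnitScaleTiltProp8FlatCubeQContraction
import HarnessLib

/-!
# Route `UnitScaleTilt`, crux K1 child «MinimiserStabilityRegPr» (stmt-QuantumFields-19200), v8 pillar **P2 `stub_flatOpsCubeSeq`** — the SECOND-ORDER row (k3) of
# `FlatOpsHRowsFromKernels.HKernelRows` (gap C-B11-F1): **[Balaban1985Variational] (137) AT `U = 1` IS AN EXACT IDENTITY OF p21's SECT. A ALGEBRA —
# `∂*∂(HX) = Q*((QGQ*)⁻¹X − aX)` FOR EVERY NESTED FAMILY — so `∂*∂H` has NO propagator in it: its kernel is the kernel of `(QGQ*)⁻¹` ([Balaban1984PropagatorsII] Prop. 2.7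
# (2.149), the port's `B6Prop27KLevelV1`) read through the LOCAL adjoint averaging `Q*`**

Cell `ym3-torus` (HUMAN RULING D-0037, YM ladder rung R3), seat `ym3-torus-p1` gen 16.  `--supports stmt-QuantumFields-19200 --as helper`; count-neutral; def-free.

THE PRINT.  [Balaban1985Variational] p. 298 (137): *«(3.126) [5] yields Δ_πH = (Δ_π + DRD* + Q*aQ)H − Q*a(L^{j(·)}η)⁻¹ = Q*(QGQ*)⁻¹(L^{j(·)}η)⁻¹ − Q*a(L^{j(·)}η)⁻¹, hence
|Δ_πHB|_{(−3)} ≦ O(1)|B|. Above we have used the equality RD*H = 0.»* (at `U₀ = 1`: `Δ_π = D*D = ∂^{η*}∂^η`; `(L^{j(·)}η)⁻¹` is print's data normalisation `H₀ = H∘diag((L^{j(c)}η)⁻¹)`);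
(139)–(140) p. 299 then pass to `Δ_{U₀}H` through `Δ = D*D + Δ′` and `D*DH = (D*D + DD*)H − DPD*H`.  [Balaban1984PropagatorsII] (2.19) `Δ_a = ∂*∂ + ∂R∂* + Q*aQ`, (2.22) `Δ_aG = 1`,
(2.35) `H = GQ*(QGQ*)⁻¹`, `QH = 1`, (2.34) `R∂*GQ* = 0`; Prop. 2.7 (2.149) p. 249: *«|(QGQ*)⁻¹(y, y′)| ≦ O(1)(Lʲη)⁻²(L^{j′}η)^{−d}e^{−δ₄d(y,y′)}»*.

WHAT IS PROVED (sorry-free; axioms standard; no definition).  For EVERY `D : B6SectADomainsV1.Domains P`, lattice factor `c ≠ 0`, weights `w > 0`: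
* §1 **`curlCurl_hOp`**: `∂*∂(HB) = Q*((QGQ*)⁻¹B) − Q*(aB)` — from p1 g15's `FlatCubeOperators.deltaAE_hOp` (`Δ_a H = Q*(QGQ*)⁻¹`), `RE_dsE_hOp` (`R∂*H = 0`), `QE_hOp` (`QH = 1`)
  and the definition (2.19); at the carrier **`curlCurl_flatH`**: `∂*∂(flatH X) = Q*((QGQ*)⁻¹X − X)` (`a ≡ 1`);
* §2 the adjoint averaging is LOCAL: `QsE_apply_eq_sum` (`(Q*ω)(b) = Σ_{c′} ω(c′)·(Qe_b)(c′)` for an indicator `e_b`), `abs_QE_indicator_le_one` (`|(Qe_b)(c′)| ≤ 1`),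
  `QE_indicator_eq_zero` (`(Qe_b)(c′) = 0` unless the `j(c′)`-blocks of the end-points of `b` are end-points of `c′`) — p1 g16's sup-contraction
  `FlatCubeQContraction.abs_bondAvgIter_le_of_blocks`;
* §3 **`abs_curlCurl_flatH_le`**: `|(∂*∂ flatH e_c)(b)| ≤ Σ_{c′} |(Qe_b)(c′)|·|((QGQ*)⁻¹e_c)(c′) − e_c(c′)|` — the (k3) entry of `HKernelRows` is a finite local combination (the
  index bonds `c′` lying over `b`, at most two per level) of the entries of `(QGQ*)⁻¹`; so **(k3) = [Balaban1984PropagatorsII] Prop. 2.7 (2.149) for the family, nothing else**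
  (for the one-level family: the [Balaban1984PropagatorsI] (1.62)-type decay of `(Q_kG_kQ_k*)⁻¹`).
HONEST SCOPE.  (k4) (the Laplacian row) needs in addition `∂∂*H = ∂P∂*H` bounded ((140), `P = 1 − R`, [Balaban1984PropagatorsII] (2.36)–(2.46)) — not here; no estimate
of `(QGQ*)⁻¹` is proved here.  NOT a claim about the mass gap.

References: T. Bałaban, CMP **102** (1985) 277–309 [Balaban1985Variational] (137)–(140) p.298–299; CMP **96** (1984) 223–250 [Balaban1984PropagatorsII] (2.19)–(2.22) p.226,
(2.34)–(2.35) p.228, Prop. 2.7 (2.149) p.249; CMP **95** (1984) 17–40 [Balaban1984PropagatorsI] (1.11) p.19, (1.18) p.20.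
-/

set_option autoImplicit false

noncomputable section

open scoped BigOperators InnerProductSpace

namespace Summit.QuantumFields.YangMills.Theorems.FlatHCurlCurl

open Literature.MathematicalPhysics.QuantumFieldTheory.Balaban1983to89
open Literature.MathematicalPhysics.QuantumFieldTheory.BalabanImbrieJaffe1984to88.BIJ85AxialPropagator411 (BondSpace)
open LatticeFieldCalculus (bondAvgIter)
open B6SectADomainsV1 (Domains)
open B6SectAOperatorsV1 (BondIdx BondIdxSpace QE QsE aE dE dsE dcE dcsE RE QE_apply aE_apply inner_QsE_left inner_eq_sum)
open B6SectAVectorModelV1 (deltaAE GE EE deltaAE_def)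
open B6SectA (hOp)
open B5Eq118OneStroke (iterBlockOf)
open T3ContinuumYM3Torus (T3Family)
open FlatOpsLettersAssembly (flatH)
open FlatCubeQContraction (abs_bondAvgIter_le_of_blocks)

variable {P : Params} (D : Domains P)

/-! ## §1 (137): `∂*∂H = Q*((QGQ*)⁻¹ − a)` -/

/-- **[Balaban1985Variational] (137) AT `U = 1`, EXACT**: `∂*∂(HB) = Q*((QGQ*)⁻¹B) − Q*(aB)` for `H = GQ*(QGQ*)⁻¹` of ANY nested family — `Δ_aH = Q*(QGQ*)⁻¹`,
`R∂*H = 0`, `QH = 1` and `Δ_a = ∂*∂ + ∂R∂* + Q*aQ`. [cite: Balaban1985Variational, (137) p.298; Balaban1984PropagatorsII, (2.19) p.226, (2.34)-(2.35) p.228] -/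
theorem curlCurl_hOp {c : ℝ} (hc : c ≠ 0) {w : BondIdx D → ℝ} (hw : ∀ i, 0 < w i) (B : BondIdxSpace D) :
    dcsE c (dcE c (hOp (GE D hc hw) (QsE D) (EE D hc hw) B)) = QsE D (EE D hc hw B) - QsE D (aE D w B) := by
  have h := FlatCubeOperators.deltaAE_hOp D hc hw B
  rw [deltaAE_def] at h
  simp only [LinearMap.add_apply, LinearMap.comp_apply, FlatCubeOperators.RE_dsE_hOp, map_zero, add_zero,
    FlatCubeOperators.QE_hOp] at h
  exact eq_sub_of_add_eq h

section Carrier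

variable (F : T3Family) (n K : ℕ) (DF : Domains (F.P K))

/-- **(137) FOR THE TEXT'S `flatH`** (`a ≡ 1`, lattice factor `L^{K−n}`): `∂*∂(flatH X) = Q*((QGQ*)⁻¹X − X)`. [cite: Balaban1985Variational, (137) p.298] -/
theorem curlCurl_flatH (X : BondIdx DF → ℝ) :
    dcsE ((F.L : ℝ) ^ (K - n)) (dcE ((F.L : ℝ) ^ (K - n)) (WithLp.toLp 2 (flatH F n K DF X))) =
      QsE DF (EE DF (c := (F.L : ℝ) ^ (K - n)) (pow_ne_zero _ (Nat.cast_ne_zero.2 (F.P K).L_pos.ne')) (w := fun _ => (1 : ℝ)) (fun _ => one_pos)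
        (WithLp.toLp 2 X) - WithLp.toLp 2 X) := by
  have hflat : WithLp.toLp 2 (flatH F n K DF X) =
      hOp (GE DF (c := (F.L : ℝ) ^ (K - n)) (pow_ne_zero _ (Nat.cast_ne_zero.2 (F.P K).L_pos.ne')) (w := fun _ => (1 : ℝ)) (fun _ => one_pos))
        (QsE DF) (EE DF (c := (F.L : ℝ) ^ (K - n)) (pow_ne_zero _ (Nat.cast_ne_zero.2 (F.P K).L_pos.ne')) (w := fun _ => (1 : ℝ)) (fun _ => one_pos))
        (WithLp.toLp 2 X) := by
    ext b
    exact FlatOpsLettersAssembly.isFlatH_flatH F n K DF X b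
  have ha : aE DF (fun _ => (1 : ℝ)) (WithLp.toLp 2 X) = WithLp.toLp 2 X := by
    ext i
    rw [aE_apply, one_mul]
  rw [hflat, curlCurl_hOp, ha, map_sub]

end Carrier

/-! ## §2 The adjoint averaging `Q*` is local -/

/-- **`(Q*ω)(b) = Σ_{c′} ω(c′)·(Qe_b)(c′)`** for an indicator `e_b` of the fine bond `b` (the adjoint read componentwise). [cite: Balaban1984PropagatorsII, (2.18)-(2.20) p.226] -/
theorem QsE_apply_eq_sum (ω : BondIdxSpace D) (b : PBond P 0) (eb : BondSpace P) (heb : eb b = 1) (heb' : ∀ b', b' ≠ b → eb b' = 0) :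
    QsE D ω b = ∑ c', ω c' * QE D eb c' := by
  have h1 : QsE D ω b = ⟪QsE D ω, eb⟫_ℝ := by
    rw [inner_eq_sum, Finset.sum_eq_single b]
    · rw [heb, mul_one]
    · intro b' _ hb'
      rw [heb' b' hb', mul_zero]
    · intro h; exact absurd (Finset.mem_univ b) h
  rw [h1, inner_QsE_left, inner_eq_sum]

/-- the average of an indicator is at most one in absolute value. [cite: Balaban1984PropagatorsI, (1.11) p.19, (1.18) p.20] -/
theorem abs_QE_indicator_le_one (b : PBond P 0) (eb : BondSpace P) (heb : eb b = 1) (heb' : ∀ b', b' ≠ b → eb b' = 0) (c' : BondIdx D) :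
    |QE D eb c'| ≤ 1 := by
  rw [QE_apply]
  have hj : (c'.1.1 : ℕ) ≤ P.m + P.K := le_trans (Nat.lt_succ_iff.1 c'.1.1.isLt) D.hk
  refine abs_bondAvgIter_le_of_blocks (c'.1.1 : ℕ) hj Set.univ (WithLp.ofLp eb) 1 (fun b'' _ _ => ?_) c'.1.2 (Set.mem_univ _) (Set.mem_univ _)
  by_cases h : b'' = b
  · subst h
    show |eb b''| ≤ 1
    rw [heb, abs_one]
  · show |eb b''| ≤ 1
    rw [heb' b'' h, abs_zero]
    exact zero_le_one

/-- **LOCALITY**: `(Qe_b)(c′) = 0` unless the `j(c′)`-blocks of BOTH end-points of `b` are end-points of `c′`. [cite: Balaban1984PropagatorsI, (1.11) p.19, (1.18) p.20] -/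
theorem QE_indicator_eq_zero (b : PBond P 0) (eb : BondSpace P) (heb' : ∀ b', b' ≠ b → eb b' = 0) (c' : BondIdx D)
    (h : ¬ ((iterBlockOf (c'.1.1 : ℕ) b.src = c'.1.2.src ∨ iterBlockOf (c'.1.1 : ℕ) b.src = c'.1.2.tgt) ∧
      (iterBlockOf (c'.1.1 : ℕ) b.tgt = c'.1.2.src ∨ iterBlockOf (c'.1.1 : ℕ) b.tgt = c'.1.2.tgt))) :
    QE D eb c' = 0 := by
  rw [QE_apply]
  have hj : (c'.1.1 : ℕ) ≤ P.m + P.K := le_trans (Nat.lt_succ_iff.1 c'.1.1.isLt) D.hk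
  have h0 := abs_bondAvgIter_le_of_blocks (c'.1.1 : ℕ) hj {y | y = c'.1.2.src ∨ y = c'.1.2.tgt} (WithLp.ofLp eb) 0
    (fun b'' hs ht => ?_) c'.1.2 (Or.inl rfl) (Or.inr rfl)
  · exact abs_nonpos_iff.1 h0
  · by_cases hb : b'' = b
    · subst hb
      exact absurd ⟨hs, ht⟩ h
    · show |eb b''| ≤ 0
      rw [heb' b'' hb, abs_zero]

/-! ## §3 The (k3) entry of `HKernelRows` through the entries of `(QGQ*)⁻¹` -/

section CarrierBound

variable (F : T3Family) (n K : ℕ) (DF : Domains (F.P K))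

/-- **THE `∂*∂H` ENTRY IS A LOCAL COMBINATION OF `(QGQ*)⁻¹` ENTRIES**: for indicator data `e_c` at an index bond and an indicator `e_b` of the fine bond `b`,
`|(∂*∂ flatH e_c)(b)| ≤ Σ_{c′} |(Qe_b)(c′)|·|((QGQ*)⁻¹e_c)(c′) − e_c(c′)|`, where `(Qe_b)(c′)` vanishes off the index bonds lying over `b` (§2) and is `≤ 1` — so row (k3) of
`FlatOpsHRowsFromKernels.HKernelRows` follows from the kernel decay of `(QGQ*)⁻¹` ([Balaban1984PropagatorsII] Prop. 2.7 (2.149)) and nothing else.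
[cite: Balaban1985Variational, (137) p.298; Balaban1984PropagatorsII, Prop. 2.7 (2.149) p.249] -/
theorem abs_curlCurl_flatH_le (X : BondIdx DF → ℝ) (b : PBond (F.P K) 0) (eb : BondSpace (F.P K)) (heb : eb b = 1)
    (heb' : ∀ b', b' ≠ b → eb b' = 0) :
    |(dcsE ((F.L : ℝ) ^ (K - n)) (dcE ((F.L : ℝ) ^ (K - n)) (WithLp.toLp 2 (flatH F n K DF X)))) b| ≤
      ∑ c', |QE DF eb c'| *
        |EE DF (c := (F.L : ℝ) ^ (K - n)) (pow_ne_zero _ (Nat.cast_ne_zero.2 (F.P K).L_pos.ne')) (w := fun _ => (1 : ℝ)) (fun _ => one_pos)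
            (WithLp.toLp 2 X) c' - X c'| := by
  rw [curlCurl_flatH, QsE_apply_eq_sum DF _ b eb heb heb']
  refine (Finset.abs_sum_le_sum_abs _ _).trans (Finset.sum_le_sum fun c' _ => ?_)
  rw [abs_mul, mul_comm]
  rfl

end CarrierBound

end Summit.QuantumFields.YangMills.Theorems.FlatHCurlCurl

end
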